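import Literature.IUT.HodgeArakelov.LocalTriMuDataIsoArch

/-!
# [IUTchII] Def 4.9 (vii) / Cor 4.10 (iv): "passing to `O^{×μ}`" is NOT surjective on isomorphisms for the
# typed local data — a kernel witness (independence result over the Def 4.9 interfaces)

S. Mochizuki, *Inter-universal Teichmüller theory II*, kurims Dec-2020 manuscript, Def 4.9 (iii) p.155,
(iv) p.156, (vii) p.158, Cor 4.10 (iv) p.160 [cite: Mochizuki2012, Def 4.9 (vii) p.158]. Claim key
DISPUTED (D-0012): nothing here asserts a disputed claim or takes a side on [IUTchIII] Cor 3.12. WITNESS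
file (abc-iut cell, wave-4 seat abc-iut-w4-d028, finding W4D028-F1; companion to abc-iut-L6-t2's
`LocalTriMuDataIso.lean` p410596, which it imports unchanged).

**What print says.** Def 4.9 (iii)/(iv): the local datum `‡F^{⊢▶×μ}_w` is the split-`×μ`-Kummer MODEL
Frobenioid on the DIRECT PRODUCT monoid `O^{▶×μ}(‡A) := O^▶(‡A) × O^{×μ}(‡A)` ("the `‡G`-module obtained by
evaluating at `‡A` the group of units `O^×(−)` (respectively, the monoid `O^▷(−)`) associated to this
Frobenioid may be naturally identified with `O^{×μ}(‡A)` (respectively, `O^{▶×μ}(‡A))`"), with `O^▶`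
"abstractly isomorphic to `ℕ`" (Def 4.9 (viii) p.158); a morphism of `F^{⊢▶×μ}`-prime-strips is "a collection
of isomorphisms, indexed by `V`, between the various constituent objects of the prime-strips" (Def 4.9 (vii)).
For THESE objects the map `Isom_{F^{⊢▶×μ}}(−,−) → Isom_{F^{⊢×μ}}(−,−)` ("passing to the isometries",
Def 4.9 (vi)) is surjective by construction — which is the content of Cor 4.10 (iv) p.160 ("one obtains a
poly-isomorphism `†F^{⊢×μ}_△ ⥲ ‡F^{⊢×μ}_△` which coincides with the full poly-isomorphism"), of
[IUTchIII] Thm 1.5 (ii) and of [IUTchIII] Thm 2.2 (i) ("the second arrows … are surjections").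

**What the tree types.** `NonarchTriMuDatum.Iso D D'` (`LocalTriMuDataIso.lean`) is an isomorphism
`e : O^▷(‡A) ≃* O^▷(‡A')` of the GENERATING `F^⊢`-datum — the full monoid with its torsion units, the
splitting image, the `×`-Kummer `Ẑ^×`-orbit and the `×μ`-orbit — and `NonarchTriMuDatum.MuIso` is an
isomorphism of the `×μ`-data; `Iso.toMuIso` is "passing to `O^{×μ}`".

**What is shown here (kernel).** Over abc-iut-L6-t2's interfaces AS TYPED, iso-surjectivity of
"passing to `O^{×μ}`" does NOT follow: for every `l` there is a good-nonarchimedean local datum `D₀ l`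
(monoid `O^▷ :=` the group `ℤ` written multiplicatively, trivial group `‡G := 1`, group-theoretic units
`O^×(G) := O^×` with `Im(Ẑ^×) := 1` so that the `×`-Kummer orbit is the single isomorphism `id` — the typed
shadow of "any `×`-Kummer structure is unique", Remark 1.11.1 (b) — and `Ism :=` all equivariant
automorphisms) such that
* every `f : Iso (D₀ l) (D₀ l)` is the identity on units (`Iso.mapEquiv_units_eq`), hence `f.toMuIso` is the
  identity of `O^{×μ}` (`Iso.toMuIso_eMu_apply`), while
* inversion of `O^{×μ} ≅ ℤ` IS a `MuIso (D₀ l) (D₀ l)` (`muInv`) and is not the identity;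
* hence `¬ Function.Surjective Iso.toMuIso` (`not_surjective_toMuIso`), also in the by-place-type wrapper
  `LocalTriMuDatum.Iso.toMuIso` (`not_surjective_localTriMuDatum_toMuIso`).
The obstruction lives on the UNITS (the `×`-Kummer rigidity pins `e|_{O^×}`, the `×μ`-orbit does not pin
`e|_{O^{×μ}}`); it is insensitive to the value-group part, so adding a rigid `O^▶ ≅ ℕ` factor changes nothing.

**What this is NOT.** Not a claim about the arithmetic local data `O^▷_{F̄_v}`; not a claim that Cor 4.10 (iv)
is false. It records that the three tree-level copies of the same residual — `HodgeTheaterStrips.UnitMuCoric`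
([IUTchII] Cor 4.10 (iv), FACT-LIST F-2065), `ThetaLinkData.induced_full` ([IUTchIII] Thm 1.5 (ii)) and
`ThetaMonoidData.mapAut_surjective` ([IUTchIII] Thm 2.2 (i)) — are NOT dischargeable by definitional
unwinding once the frame's `F^{⊢▶×μ} ↦ F^{⊢×μ}` is instantiated by `Iso.toMuIso` as typed, whereas over
print's direct-product objects they are; i.e. the typed morphism notion is strictly finer than print's at
nonarchimedean places (cf. abc-iut-L6-d3's advisory A2 for the archimedean `MuIso`).
-/

namespace Literature.IUT.HodgeArakelov

namespace TriMuSurjectivityWitness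

open Multiplicative

/-- **IUTchII:Def4.9(iii)** (kurims p.155) the witness monoid `O^▷ :=` the group `ℤ`, written
multiplicatively (every element is a unit; the value-group part `O^▷/O^×` is trivial), bundled.
[cite: Mochizuki2012, Def 4.9 (iii) p.155] -/
abbrev C₀ : CommMonCat.{0} := CommMonCat.of (Multiplicative ℤ)

/-- **IUTchII:Def4.9(i)** (kurims p.154) the witness covering monoid: `O^▷ = ℤ` (multiplicative) with the
TRIVIAL action of the trivial group `‡G := 1`. [cite: Mochizuki2012, Def 4.9 (i) p.154] -/
abbrev M₀ : CoveringMonoid.{0, 0} PUnit.{1} := ⟨C₀, 1⟩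

/-- **IUTchII:Def4.9(i)** (kurims p.154) the witness group-theoretic units: `O^×(G) := O^×` with the
induced (trivial) action, NO open subgroups (so `Ism` = all equivariant automorphisms of `O^{×μ}`) and
`Im(Ẑ^×) := 1` (so a `×`-Kummer structure is ONE isomorphism — the typed shadow of the uniqueness of
`×`-Kummer structures, Remark 1.11.1 (b)). [cite: Mochizuki2012, Def 4.9 (i) p.154] -/
abbrev X₀ : GroupTheoreticUnits.{0, 0} PUnit.{1} where
  OxG := M₀.Oˣ
  act := M₀.unitsAct
  openSubgroups := ∅
  zhatUnits := ⊥
  zhatUnits_comm γ hγ g := by rw [Subgroup.mem_bot.mp hγ, one_mul, mul_one]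

/-- **IUTchII:Def4.9(i)** (kurims p.154) the identity `O^×(G) = O^× ⥲ O^×(A)` as an equivariant isomorphism.
[cite: Mochizuki2012, Def 4.9 (i) p.154] -/
def κ₀ : EquivariantIso X₀.act M₀.unitsAct := ⟨MulEquiv.refl _, fun _ _ => rfl⟩

/-- **IUTchII:Def4.9(i)** (kurims p.154) the `×`-Kummer structure of the witness: the single isomorphism
`id` (a `1`-orbit). [cite: Mochizuki2012, Def 4.9 (i) p.154] -/
def kummerTimes₀ : KummerTimes X₀ M₀ where
  orbit := {κ' | κ'.toMulEquiv = MulEquiv.refl _}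
  isOrbit := by
    refine ⟨κ₀, rfl, fun κ' => ?_⟩
    have hκ₀ : κ₀.toMulEquiv = MulEquiv.refl M₀.Oˣ := rfl
    have h1 : MulEquiv.trans (1 : MulAut M₀.Oˣ) (MulEquiv.refl M₀.Oˣ) = MulEquiv.refl M₀.Oˣ :=
      MulEquiv.ext fun _ => rfl
    rw [hκ₀]
    constructor
    · intro (h : κ'.toMulEquiv = MulEquiv.refl _)
      exact ⟨1, Subgroup.one_mem _, by rw [h1]; exact h⟩
    · rintro ⟨γ, hγ, hκ'⟩
      have hγ1 : γ = 1 := Subgroup.mem_bot.mp hγ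
      rw [hγ1, h1] at hκ'
      exact hκ'

/-- **IUTchII:Def4.9(i)** (kurims p.154) every equivariant isomorphism `O^{×μ}(G) ⥲ O^{×μ}(A)` of the
witness differs from the identity by an element of `Ism` (there are no open subgroups, and equivariance
IS commutation with the action). [cite: Mochizuki2012, Def 4.9 (i) p.154] -/
theorem mem_isometryGroup_of_equivariant
    (κ : EquivariantIso (actionModTorsion X₀.act) M₀.unitsModTorsionAct) :
    (κ.toMulEquiv : MulAut (ModTorsion X₀.OxG)) ∈ isometryGroup X₀.act X₀.openSubgroups := by
  refine ⟨fun g => ?_, fun H hH => hH.elim⟩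
  apply MulEquiv.ext
  intro u
  rw [MulAut.mul_apply, MulAut.mul_apply]
  exact κ.map_act g u

/-- **IUTchII:Def4.9(i)** (kurims p.154) the `×μ`-Kummer structure of the witness: the `Ism`-orbit of the
identity of `O^{×μ}`. [cite: Mochizuki2012, Def 4.9 (i) p.154] -/
def kummerTimesMu₀ : KummerTimesMu X₀ M₀ where
  orbit := {κ' | ∃ γ ∈ isometryGroup X₀.act X₀.openSubgroups,
    κ'.toMulEquiv = γ.trans (MulEquiv.refl (UnitsModTorsion M₀.O))}
  isOrbit := by
    have h1 : MulEquiv.trans (1 : MulAut (UnitsModTorsion M₀.O)) (MulEquiv.refl _) = MulEquiv.refl _ :=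
      MulEquiv.ext fun _ => rfl
    exact ⟨⟨MulEquiv.refl _, fun _ _ => rfl⟩, ⟨1, Subgroup.one_mem _, h1.symm⟩, fun κ' => Iff.rfl⟩

/-- **IUTchII:Def4.9(i)** (kurims p.154) in the witness EVERY equivariant isomorphism of the `×μ`-data lies
in the `×μ`-Kummer orbit (the orbit does not pin anything). [cite: Mochizuki2012, Def 4.9 (i) p.154] -/
theorem mem_kummerTimesMu₀_orbit
    (κ : EquivariantIso (actionModTorsion X₀.act) M₀.unitsModTorsionAct) : κ ∈ kummerTimesMu₀.orbit :=
  ⟨κ.toMulEquiv, mem_isometryGroup_of_equivariant κ, MulEquiv.ext fun _ => rfl⟩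

/-- **IUTchII:Def4.9(iv)** (kurims p.156) the presentation `O^⊥ ⥲ O^▷/O^×` holds trivially for a group with
the trivial splitting (both sides are one point). [cite: Mochizuki2012, Def 4.9 (iv) p.156] -/
theorem presents₀ : OPerpPresentsAssociates (M₀.O) 1 ⊥ := by
  constructor
  · intro a
    obtain ⟨b, rfl⟩ := Associates.mk_surjective a
    refine ⟨1, Submonoid.one_mem _, ?_⟩
    change Associates.mk 1 = Associates.mk b
    rw [Associates.mk_eq_mk_iff_associated]
    exact ⟨toUnits b, by simp⟩
  · intro x hx y hy
    rw [OPerp_one, Submonoid.mem_bot] at hx hy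
    subst hx; subst hy
    exact iff_of_true rfl ⟨1, Subgroup.one_mem _, by simp⟩

/-- **IUTchII:Def4.9(iv)** (kurims p.156) THE WITNESS DATUM `D₀ l` (good nonarchimedean type, so `2l ↦ 1`):
`O^▷ := ℤ` multiplicatively, trivial `‡G`-action, trivial splitting, `×`-Kummer orbit `{id}`, `×μ`-Kummer
orbit = all equivariant isomorphisms. An honest inhabitant of abc-iut-L6-t2's interface for every `l`.
[cite: Mochizuki2012, Def 4.9 (iv) p.156] -/
def D₀ (l : ℕ) : NonarchTriMuDatum.{0, 0, 0} l PlaceKind.goodNonarch PUnit.{1} X₀ where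
  O := C₀
  act := 1
  splitting := ⊥
  presents := presents₀
  kummerTimes := kummerTimes₀
  kummerTimesMu := kummerTimesMu₀

variable (l : ℕ)

/-- **IUTchII:Def4.9(vii)** (kurims p.158) RIGIDITY OF THE TYPED ISOMORPHISMS: every isomorphism of the
witness datum with itself is the identity on units — forced by the field `mem_kummerTimes_iff` (the
`×`-Kummer orbit `{id}` must be carried to itself). [cite: Mochizuki2012, Def 4.9 (vii) p.158] -/
theorem Iso.mapEquiv_units_eq (f : NonarchTriMuDatum.Iso (D₀ l) (D₀ l)) (u : (M₀.O)ˣ) :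
    Units.mapEquiv f.e u = u := by
  have h : (NonarchTriMuDatum.transportTimes (D₀ l) (D₀ l) f.e f.map_act κ₀).toMulEquiv =
      MulEquiv.refl _ :=
    (f.mem_kummerTimes_iff κ₀).mpr (rfl : κ₀.toMulEquiv = MulEquiv.refl _)
  exact MulEquiv.congr_fun h u

/-- **IUTchII:Def4.9(vii)** (kurims p.158) hence "passing to `O^{×μ}`" sends EVERY typed isomorphism of the
witness datum to the identity of `O^{×μ}`. [cite: Mochizuki2012, Def 4.9 (vii) p.158] -/
theorem Iso.toMuIso_eMu_apply (f : NonarchTriMuDatum.Iso (D₀ l) (D₀ l)) (x : UnitsModTorsion (M₀.O)) :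
    f.toMuIso.eMu x = x := by
  induction x using QuotientGroup.induction_on with
  | H u =>
    change MulEquivModTorsion (Units.mapEquiv f.e) (QuotientGroup.mk u) = QuotientGroup.mk u
    rw [mulEquivModTorsion_mk, Iso.mapEquiv_units_eq]
    rfl

/-- **IUTchII:Def4.9(vii)** (kurims p.158) INVERSION of `O^{×μ}` is an isomorphism of the `×μ`-data of the
witness (equivariant, and the `×μ`-Kummer orbit — all equivariant isomorphisms — is carried to itself).
[cite: Mochizuki2012, Def 4.9 (vii) p.158] -/
def muInv : NonarchTriMuDatum.MuIso (D₀ l) (D₀ l) where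
  eMu := MulEquiv.inv _
  map_act g x := by
    change ((D₀ l).covering.unitsModTorsionAct g x)⁻¹ = (D₀ l).covering.unitsModTorsionAct g x⁻¹
    exact (map_inv ((D₀ l).covering.unitsModTorsionAct g) x).symm
  mem_kummerTimesMu_iff κ :=
    iff_of_true (mem_kummerTimesMu₀_orbit _) (mem_kummerTimesMu₀_orbit κ)

/-- **IUTchII:Def4.9(i)** (kurims p.154) the class of `1 ∈ ℤ` (multiplicatively: of `ofAdd 1`) in
`O^{×μ} = O^×/O^μ`. [cite: Mochizuki2012, Def 4.9 (i) p.154] -/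
def x₁ : UnitsModTorsion (M₀.O) := QuotientGroup.mk (toUnits (ofAdd (1 : ℤ)))

/-- **IUTchII:Def4.9(i)** (kurims p.154) `x₁` is not its own inverse in `O^{×μ}` (its square `2 ∈ ℤ` is not
torsion). [cite: Mochizuki2012, Def 4.9 (i) p.154] -/
theorem x₁_inv_ne : (x₁)⁻¹ ≠ x₁ := by
  intro h
  have hsq : x₁ * x₁ = 1 := by
    rw [show x₁ * x₁ = x₁⁻¹ * x₁ by rw [h], inv_mul_cancel]
  have hmem : toUnits (ofAdd (1 : ℤ)) * toUnits (ofAdd (1 : ℤ)) ∈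
      CommGroup.torsion ((M₀.O)ˣ) := by
    rw [← QuotientGroup.eq_one_iff]
    exact hsq
  rw [CommGroup.mem_torsion, isOfFinOrder_iff_pow_eq_one] at hmem
  obtain ⟨n, hn, hpow⟩ := hmem
  have h3 : (ofAdd ((1 : ℤ) + 1)) ^ n = (1 : Multiplicative ℤ) := by
    apply (toUnits (G := Multiplicative ℤ)).injective
    rw [map_pow, map_one, ofAdd_add, map_mul]
    exact hpow
  rw [← ofAdd_nsmul, ← ofAdd_zero] at h3
  have h4 : n • ((1 : ℤ) + 1) = 0 := ofAdd.injective h3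
  rw [nsmul_eq_mul] at h4
  omega

/-- **IUTchII:Cor4.10(iv)** (kurims p.160) no typed isomorphism of the witness datum passes to the inversion
of `O^{×μ}`. [cite: Mochizuki2012, Cor 4.10 (iv) p.160] -/
theorem Iso.toMuIso_ne_muInv (f : NonarchTriMuDatum.Iso (D₀ l) (D₀ l)) : f.toMuIso ≠ muInv l := by
  intro h
  have h1 : f.toMuIso.eMu x₁ = x₁ := Iso.toMuIso_eMu_apply l f x₁
  rw [h] at h1
  change (x₁)⁻¹ = x₁ at h1
  exact x₁_inv_ne h1

/-- **IUTchII:Cor4.10(iv)** (kurims p.160) **THE WITNESS**: over abc-iut-L6-t2's Def 4.9 interfaces as typed,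
"passing to `O^{×μ}`" (`NonarchTriMuDatum.Iso.toMuIso`) is NOT surjective on isomorphisms — so the
iso-surjectivity `Isom_{F^{⊢▶×μ}} ↠ Isom_{F^{⊢×μ}}` behind Cor 4.10 (iv) / [IUTchIII] Thm 1.5 (ii) / Thm 2.2 (i)
is not a formal consequence of the typed morphism notion (it IS formal for print's direct-product objects
`O^▶ × O^{×μ}`, Def 4.9 (iii)/(iv)). [cite: Mochizuki2012, Cor 4.10 (iv) p.160] -/
theorem not_surjective_toMuIso :
    ¬ Function.Surjective
      (NonarchTriMuDatum.Iso.toMuIso : NonarchTriMuDatum.Iso (D₀ l) (D₀ l) → NonarchTriMuDatum.MuIso (D₀ l) (D₀ l)) := by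
  intro h
  obtain ⟨f, hf⟩ := h (muInv l)
  exact Iso.toMuIso_ne_muInv l f hf

/-- **IUTchII:Cor4.10(iv)** (kurims p.160) the same for the by-place-type wrapper
`LocalTriMuDatum.Iso.toMuIso` (`LocalTriMuDataIsoArch.lean`) at the good nonarchimedean datum `good (D₀ l)` —
the shape in which the `F^{⊢▶×μ}`- and `F^{⊢×μ}`-prime-strip groupoids consume the local data place by place.
[cite: Mochizuki2012, Cor 4.10 (iv) p.160] -/
theorem not_surjective_localTriMuDatum_toMuIso :
    ¬ Function.Surjective
      (LocalTriMuDatum.Iso.toMuIso :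
        LocalTriMuDatum.Iso (LocalTriMuDatum.good (D₀ l)) (LocalTriMuDatum.good (D₀ l)) →
          LocalTriMuDatum.MuIso (LocalTriMuDatum.good (D₀ l)) (LocalTriMuDatum.good (D₀ l))) := by
  intro h
  apply not_surjective_toMuIso l
  intro m
  obtain ⟨f, hf⟩ := h m
  exact ⟨f, hf⟩

end TriMuSurjectivityWitness

end Literature.IUT.HodgeArakelov
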